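import Literature.NumberTheory.LFunctions.WeilMarkovQuadratic
import HarnessLib

/-!
# Window bookkeeping of the Markov form on the two-prime range `(log 3)/2 < b ≤ log 2`

In the Markov decomposition `Re Q(g) = P(g) + 𝓔_b(g) − M_b ‖g‖₂²` of Weil's quadratic functional on
a window `[-b, b]` (`WeilMarkovQuadratic.lean`) the prime powers that enter are indexed by
`weilPrimeIndex b = {n ≤ ⌊e^{2b}⌋ : log n < 2b}`.  On the TWO-PRIME range `(log 3)/2 < b ≤ log 2`
this index set consists of `n ∈ {0, 1, 2, 3}` (`log n < 2b ≤ log 4` forces `n < 4`), the summands at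
`n = 0, 1` vanish (`Λ 0 = Λ 1 = 0`), and `2, 3 ∈ weilPrimeIndex b` with
`Λ(2) 2^{-1/2} = log 2/√2`, `Λ(3) 3^{-1/2} = log 3/√3`.  Hence

* `M_b = 2 (log 2/√2 + log 3/√3) + 2 ∫₀^∞ (e^{t/2} − 1)/(2 sinh t) dt + log 4π + γ`
  (`weilMarkovConstant_twoPrime`),
* `𝓔_b(g) = (log 2/√2) D_{log 2}(g) + (log 3/√3) D_{log 3}(g) + ∫_{(0,∞)} ρ(t) D_t(g) dt`
  (`weilDirichletEnergy_twoPrime`).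

This is the window bookkeeping needed by every Rayleigh–Ritz (even trial) upper bound on the
`{2,3}`-window `((log 3)/2, log 2]` of the parity ladders, companion of the frequency-side analytic
form `weilQuadratic_re_eq_weilTwoPrimeQuadratic` (`WeilTwoPrimeQuadratic.lean`).  Template: the
first-prime version `stub_markovFirstPrime`
(`Summits/…/Theorems/WeilGroundStateGroundStateSimpleEvenMarkovFirstPrime.lean`).
Everything here is proved; there are no named facts.

## References

* H. Yoshida, *On Hermitian forms attached to zeta functions*, Adv. Stud. Pure Math. 21 (1992),
  §2 eq. (2.1) (finitely many primes on a bounded window).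
* E. Bombieri, *Remarks on Weil's quadratic functional in the theory of prime numbers I*, Rend.
  Mat. Acc. Lincei (9) 11 (2000), Thm 2 (prime side of the explicit formula).
-/

noncomputable section

open Set MeasureTheory Filter
open scoped Real Topology

namespace Literature.NumberTheory.LFunctions

/-- The prime `3` enters every window beyond the second prime: `3 ∈ weilPrimeIndex b` for
`(log 3)/2 < b`. [folklore] -/
theorem three_mem_weilPrimeIndex {b : ℝ} (hb : Real.log 3 / 2 < b) : 3 ∈ weilPrimeIndex b := by
  rw [mem_weilPrimeIndex]
  push_cast
  linarith

/-- The prime `2` enters every window beyond the second prime as well. [folklore] -/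
theorem two_mem_weilPrimeIndex_of_log_three_half_lt {b : ℝ} (hb : Real.log 3 / 2 < b) :
    2 ∈ weilPrimeIndex b := by
  rw [mem_weilPrimeIndex]
  have h23 : Real.log 2 ≤ Real.log 3 := Real.log_le_log two_pos (by norm_num)
  push_cast
  linarith

/-- Below the third prime power only `n = 2, 3` carry von Mangoldt weight: for `b ≤ log 2`,
`n ∈ weilPrimeIndex b` with `n ≠ 2`, `n ≠ 3` gives `Λ(n) = 0` (`log n < 2b ≤ log 4` forces `n ≤ 3`,
and `Λ 0 = Λ 1 = 0`). [folklore] -/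
theorem vonMangoldt_eq_zero_of_mem_weilPrimeIndex_of_le_log_two {b : ℝ} (hb : b ≤ Real.log 2)
    {n : ℕ} (hn : n ∈ weilPrimeIndex b) (h2 : n ≠ 2) (h3 : n ≠ 3) :
    (ArithmeticFunction.vonMangoldt n : ℝ) = 0 := by
  rw [mem_weilPrimeIndex] at hn
  rcases Nat.lt_or_ge n 4 with h4 | h4
  · interval_cases n
    · simp
    · simp
    · exact absurd rfl h2
    · exact absurd rfl h3
  · exfalso
    have hlog : Real.log 4 ≤ Real.log n :=
      Real.log_le_log (by norm_num) (by exact_mod_cast h4)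
    have h4' : Real.log 4 = 2 * Real.log 2 := by
      rw [show (4 : ℝ) = 2 ^ 2 by norm_num, Real.log_pow]
      push_cast
      ring
    linarith

/-- On the two-prime range the prime sum of the window collapses to its `n = 2, 3` terms:
`Σ_{n ∈ weilPrimeIndex b} Λ(n) n^{-1/2} F(n) = (log 2/√2) F(2) + (log 3/√3) F(3)` for
`(log 3)/2 < b ≤ log 2`. [folklore] -/
theorem sum_weilPrimeIndex_eq_twoPrime {b : ℝ} (hb : Real.log 3 / 2 < b) (hb2 : b ≤ Real.log 2)
    (F : ℕ → ℝ) :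
    ∑ n ∈ weilPrimeIndex b, (ArithmeticFunction.vonMangoldt n : ℝ) / Real.sqrt n * F n =
      Real.log 2 / Real.sqrt 2 * F 2 + Real.log 3 / Real.sqrt 3 * F 3 := by
  classical
  have h2 := two_mem_weilPrimeIndex_of_log_three_half_lt hb
  have h3 := three_mem_weilPrimeIndex hb
  have hsub : ({2, 3} : Finset ℕ) ⊆ weilPrimeIndex b := by
    intro n hn
    simp only [Finset.mem_insert, Finset.mem_singleton] at hn
    rcases hn with rfl | rfl
    · exact h2
    · exact h3
  rw [← Finset.sum_subset hsub fun n hn hns ↦ by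
      simp only [Finset.mem_insert, Finset.mem_singleton, not_or] at hns
      rw [vonMangoldt_eq_zero_of_mem_weilPrimeIndex_of_le_log_two hb2 hn hns.1 hns.2, zero_div,
        zero_mul],
    Finset.sum_pair (by norm_num), ArithmeticFunction.vonMangoldt_apply_prime Nat.prime_two,
    ArithmeticFunction.vonMangoldt_apply_prime Nat.prime_three]
  push_cast
  rfl

/-- **The killing constant on the two-prime range.** For `(log 3)/2 < b ≤ log 2`,
`M_b = 2 (log 2/√2 + log 3/√3) + 2 ∫₀^∞ (e^{t/2} − 1)/(2 sinh t) dt + log 4π + γ`. [cite: Bombieri2000Weil, Thm 2 (prime side), restricted to the window [−b, b]] -/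
theorem weilMarkovConstant_twoPrime {b : ℝ} (hb : Real.log 3 / 2 < b) (hb2 : b ≤ Real.log 2) :
    weilMarkovConstant b =
      2 * (Real.log 2 / Real.sqrt 2 + Real.log 3 / Real.sqrt 3) +
        2 * (∫ t in Ioi (0 : ℝ), (Real.exp (t / 2) - 1) / (2 * Real.sinh t)) +
        (Real.log (4 * Real.pi) + Real.eulerMascheroniConstant) := by
  have h := sum_weilPrimeIndex_eq_twoPrime hb hb2 fun _ ↦ 1
  simp only [mul_one] at h
  unfold weilMarkovConstant
  rw [h]

/-- **The Dirichlet energy on the two-prime range.** For `(log 3)/2 < b ≤ log 2`,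
`𝓔_b(g) = (log 2/√2) D_{log 2}(g) + (log 3/√3) D_{log 3}(g) + ∫_{(0,∞)} ρ D_t(g)`. [cite: Bombieri2000Weil, Thm 2 (prime side), restricted to the window [−b, b]] -/
theorem weilDirichletEnergy_twoPrime {b : ℝ} (hb : Real.log 3 / 2 < b) (hb2 : b ≤ Real.log 2)
    (g : ℝ → ℂ) :
    weilDirichletEnergy b g =
      Real.log 2 / Real.sqrt 2 * weilIncrement g (Real.log 2) +
        Real.log 3 / Real.sqrt 3 * weilIncrement g (Real.log 3) +
        ∫ t in Ioi (0 : ℝ), weilArchDensity t * weilIncrement g t := by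
  unfold weilDirichletEnergy
  rw [sum_weilPrimeIndex_eq_twoPrime hb hb2 fun n ↦ weilIncrement g (Real.log n)]
  push_cast
  rfl

/-- **Markov form of `Re Q` on the two-prime range** (`weilQuadratic_re_eq_weilPoleForm_add_weilDirichletEnergy_sub`
with the window bookkeeping made explicit): for a test function `g` with `tsupport g ⊆ [-b, b]`,
`(log 3)/2 < b ≤ log 2`,
`Re Q(g) = P(g) + (log 2/√2) D_{log 2}(g) + (log 3/√3) D_{log 3}(g) + ∫_{(0,∞)} ρ D_t(g) − M_b ‖g‖₂²`. [cite: Bombieri2000Weil, Thm 2; Yoshida1992, §2 eq. (2.1)] -/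
theorem weilQuadratic_re_eq_twoPrime {g : ℝ → ℂ} (hg : IsWeilTest g) {b : ℝ}
    (hb : Real.log 3 / 2 < b) (hb2 : b ≤ Real.log 2) (hsupp : tsupport g ⊆ Icc (-b) b) :
    (weilQuadratic g).re =
      weilPoleForm g +
        (Real.log 2 / Real.sqrt 2 * weilIncrement g (Real.log 2) +
          Real.log 3 / Real.sqrt 3 * weilIncrement g (Real.log 3) +
          ∫ t in Ioi (0 : ℝ), weilArchDensity t * weilIncrement g t) -
        weilMarkovConstant b * ∫ x : ℝ, ‖g x‖ ^ 2 := by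
  rw [weilQuadratic_re_eq_weilPoleForm_add_weilDirichletEnergy_sub hg hsupp,
    weilDirichletEnergy_twoPrime hb hb2]

end Literature.NumberTheory.LFunctions
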